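import Literature.Probability.RandomPlanarGeometry.SAWHalfSpaceTwoStepRate
import Literature.Probability.RandomPlanarGeometry.HammersleyWelshBound
import Literature.Probability.RandomPlanarGeometry.SAWRatioRateUpperCubeRoot
import Literature.Probability.RandomPlanarGeometry.SAWEndpointRateLowerInsertion
import Mathlib.Analysis.SpecialFunctions.Pow.Real
import HarnessLib

/-!
# Half-space walks on `ℤ^d`: the two-step ratio rate with Kesten's exponent, `|h_{N+2}/h_N − μ²| ≤ K N^{-1/3}`

Topic `Literature/Probability/RandomPlanarGeometry` (continues `SAWHalfSpaceTwoStepRate.lean`: Kesten's two-step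
inequality for half-space walks `Zd.halfSpace_kesten_additive` and the rate `Zd.halfSpaceTwoStepRate`
(`−K N^{-1/3} ≤ h_{N+2}/h_N − μ² ≤ K N^{-1/4}`); `SAWHalfSpaceConcat.lean`: `Zd.bridgeCount_mul_halfSpaceCount_le`
(`b_m h_n ≤ h_{m+n}`); `HammersleyWelshBound.lean`: `Zd.exp_mul_pow_le_bridgeCount`, `Zd.BDGS2012_HammersleyWelsh_holds`;
and the tree's abstract `1/3`-rate lemmas `Zd.KestenRateUpper.upper_rate_cubeRoot_sub`,
`Zd.KestenRateLower.lower_rate_cubeRoot_ins`).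

Source and printed status.  G. Lawler, O. Schramm, W. Werner (2004), Appendix A, (A.2): "Kesten also proved that
`lim υ_{n+2}/υ_n = β²`" for the half-space walks `υ_n = h_n` of `ℤ^d` — a LIMIT, no rate
[cite: LawlerSchrammWerner2004SAW, Appendix A, (A.2)]; N. Madras, G. Slade, *The Self-Avoiding Walk* (1993), §7.5
eq. (7.5.1), p. 255: Kesten's rate `|c_{N+2}/c_N − μ²| ≤ K N^{-1/3}` for ALL walks (no proof in the book)
[cite: MadrasSlade1993, §7.5 eq. (7.5.1)].  No rate for half-space walk ratios is located in print.  The tree's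
`Zd.halfSpaceTwoStepRate` has the upper exponent `1/4` (envelope route).  This file sharpens the upper side to
Kesten's `1/3` by feeding the SUBMULTIPLICATIVE cube-root core with the elementary cut inequality
`h_{n+k} ≤ h_n · c_k` (prefix of a half-space walk is a half-space walk, suffix an arbitrary walk) and the
Hammersley–Welsh envelope of `c_k`; the lower side is the insertion core fed with `b_m h_n ≤ h_{m+n}` and the
bridge envelope, now for every `N ≥ 1`:

  **`Zd.abs_halfSpace_twoStep_ratio_sub_le_rpow (d) : ∃ K, ∀ N ≥ 1, |h_{N+2}/h_N − μ²| ≤ K · N^{−1/3}` on `ℤ^{d+2}`.**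

## Main statements (namespace `Literature.Probability.RandomPlanarGeometry.SAW.Zd`)

* `halfSpaceCount_add_le_mul_count : h_{n+k} ≤ h_n · c_k` (every `d ≥ 1`);
* `halfSpace_kesten_all` — (7.3.3) for `h`, two-step, ALL `n ≥ 1`;
* `halfSpace_twoStep_ratio_sub_le_rpow` (upper `1/3`, `N ≥ 1`), `le_halfSpace_twoStep_ratio_sub_rpow` (lower `1/3`, `N ≥ 1`);
* **`abs_halfSpace_twoStep_ratio_sub_le_rpow`** — the two-sided statement, every `N ≥ 1`.
-/

noncomputable section

open Finset Filter Topology Literature.Probability.LatticeModels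

namespace Literature.Probability.RandomPlanarGeometry.SAW.Zd

/-! ### Cutting a half-space walk: `h_{n+k} ≤ h_n · c_k` -/

namespace HalfSpaceCut

variable {d : ℕ} [NeZero d]

/-- The prefix `ω[0..n]` (frozen after `n`). [cite: MadrasSlade1993, §1.2 eq. (1.2.3)] -/
def prefixWalk (n : ℕ) (ω : ℕ → Site d) : ℕ → Site d := fun i => ω (min i n)

/-- The suffix `ω[n..n+k]` re-based at `0` (frozen after `k`). [cite: MadrasSlade1993, §1.2 eq. (1.2.3)] -/
def suffixWalk (n k : ℕ) (ω : ℕ → Site d) : ℕ → Site d := fun i => ω (n + min i k) - ω n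

/-- The prefix of a half-space walk is a half-space walk. [cite: MadrasSlade1993, §1.2 eq. (1.2.3), Definition 3.1.2] -/
theorem prefixWalk_mem {n k : ℕ} {ω : ℕ → Site d} (hω : ω ∈ halfSpaceWalks d (n + k)) :
    prefixWalk n ω ∈ halfSpaceWalks d n := by
  obtain ⟨hωs, hωh⟩ := mem_halfSpaceWalks.1 hω
  obtain ⟨h0, -, hadj, hinj⟩ := mem_saws.1 hωs
  refine mem_halfSpaceWalks.2 ⟨mem_saws.2 ⟨?_, fun i hi => ?_, fun i hi => ?_, ?_⟩, fun i hi1 hi2 => ?_⟩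
  · simp [prefixWalk, h0]
  · simp [prefixWalk, min_eq_right hi]
  · simp only [prefixWalk, min_eq_left hi.le, min_eq_left (Nat.succ_le_of_lt hi)]
    exact hadj i (by omega)
  · intro a ha b hb hab
    simp only [Set.mem_setOf_eq] at ha hb
    simp only [prefixWalk, min_eq_left ha, min_eq_left hb] at hab
    exact hinj (show a ≤ n + k by omega) (show b ≤ n + k by omega) hab
  · simp only [prefixWalk, Nat.zero_min, min_eq_left hi2]
    exact hωh i hi1 (by omega)

omit [NeZero d] in
/-- The re-based suffix of a self-avoiding walk is a self-avoiding walk. [cite: MadrasSlade1993, §1.2 eq. (1.2.3)] -/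
theorem suffixWalk_mem {n k : ℕ} {ω : ℕ → Site d} (hω : ω ∈ saws d (n + k)) :
    suffixWalk n k ω ∈ saws d k := by
  obtain ⟨-, hend, hadj, hinj⟩ := mem_saws.1 hω
  refine mem_saws.2 ⟨?_, fun i hi => ?_, fun i hi => ?_, ?_⟩
  · simp [suffixWalk]
  · simp [suffixWalk, min_eq_right hi]
  · simp only [suffixWalk, min_eq_left hi.le, min_eq_left (Nat.succ_le_of_lt hi), zdGraph_adj_sub_right,
      show n + (i + 1) = n + i + 1 by omega]
    exact hadj (n + i) (by omega)
  · intro a ha b hb hab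
    simp only [Set.mem_setOf_eq] at ha hb
    simp only [suffixWalk, min_eq_left ha, min_eq_left hb, sub_left_inj] at hab
    have := hinj (show n + a ≤ n + k by omega) (show n + b ≤ n + k by omega) hab
    omega

/-- The cut `ω ↦ (prefix, suffix)` is injective on `(n+k)`-step half-space walks. [cite: MadrasSlade1993, §1.2 eq. (1.2.3)] -/
theorem cut_injOn (n k : ℕ) :
    Set.InjOn (fun ω : ℕ → Site d => (prefixWalk n ω, suffixWalk n k ω)) ↑(halfSpaceWalks d (n + k)) := by
  intro ω hω ω' hω' h
  rw [Finset.mem_coe] at hω hω'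
  obtain ⟨-, hend, -, -⟩ := mem_saws.1 (mem_halfSpaceWalks.1 hω).1
  obtain ⟨-, hend', -, -⟩ := mem_saws.1 (mem_halfSpaceWalks.1 hω').1
  simp only [Prod.mk.injEq] at h
  obtain ⟨hp, hs⟩ := h
  have hpre : ∀ i ≤ n, ω i = ω' i := fun i hi => by
    have := congrFun hp i
    simpa [prefixWalk, min_eq_left hi] using this
  have hn := hpre n le_rfl
  funext i
  rcases le_or_gt i n with hi | hi
  · exact hpre i hi
  rcases le_or_gt i (n + k) with hi2 | hi2
  · have := congrFun hs (i - n)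
    simp only [suffixWalk, min_eq_left (show i - n ≤ k by omega), show n + (i - n) = i by omega, hn] at this
    exact sub_left_injective this
  · rw [hend i hi2.le, hend' i hi2.le]
    have := congrFun hs k
    simp only [suffixWalk, min_self, hn] at this
    exact sub_left_injective this

end HalfSpaceCut

open HalfSpaceCut

section Cut

variable {d : ℕ} [NeZero d]

/-- **`h_{n+k} ≤ h_n · c_k`** on `ℤ^d`: cut an `(n+k)`-step half-space walk at time `n` — the prefix is an `n`-step
half-space walk, the re-based suffix a `k`-step self-avoiding walk, and the pair determines the walk.
[cite: MadrasSlade1993, §1.2 eq. (1.2.3) and Definition 3.1.2] -/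
theorem halfSpaceCount_add_le_mul_count (n k : ℕ) :
    halfSpaceCount d (n + k) ≤ halfSpaceCount d n * count d k := by
  classical
  rw [halfSpaceCount, halfSpaceCount, ← card_saws d k, ← Finset.card_product]
  refine Finset.card_le_card_of_injOn (fun ω : ℕ → Site d => (prefixWalk n ω, suffixWalk n k ω)) ?_
    (cut_injOn n k)
  intro ω hω
  rw [Finset.mem_coe] at hω
  rw [Finset.mem_coe, Finset.mem_product]
  exact ⟨prefixWalk_mem hω, suffixWalk_mem (mem_halfSpaceWalks.1 hω).1⟩

end Cut

/-! ### Kesten's two-step inequality for half-space walks, all `n ≥ 1` -/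

/-- **(7.3.3) for `h` on `ℤ^{d+2}`, two-step, every `n ≥ 1`**: there is `B ≥ max(1, μ²)` with
`h_{n+2}/h_n − B/n ≤ h_{n+4}/h_{n+2}` for all `n ≥ 1` (from `halfSpace_kesten_additive` beyond its threshold `N₁`;
below it `h_{n+2}/h_n ≤ c_2 ≤ B/n`). [cite: MadrasSlade1993, Theorem 7.3.2 (proof) and Lemma 7.3.1 (7.3.3)] -/
theorem halfSpace_kesten_all (d : ℕ) : ∃ B : ℝ, 1 ≤ B ∧ connectiveConstant (d + 2) ^ 2 ≤ B ∧ ∀ n : ℕ, 1 ≤ n →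
    (halfSpaceCount (d + 2) (n + 2) : ℝ) / halfSpaceCount (d + 2) n - B / n ≤
      (halfSpaceCount (d + 2) (n + 4) : ℝ) / halfSpaceCount (d + 2) (n + 2) := by
  obtain ⟨D, hD1, N₁, hK⟩ := halfSpace_kesten_additive d
  have ha : ∀ n, (0 : ℝ) < halfSpaceCount (d + 2) n := fun n => by
    exact_mod_cast one_le_halfSpaceCount (d := d + 2) n
  set c₂ : ℝ := (count (d + 2) 2 : ℝ) with hc₂
  have hc₂0 : 0 ≤ c₂ := Nat.cast_nonneg _
  set B : ℝ := max (max D (c₂ * ((N₁ : ℝ) + 1))) (max 1 (connectiveConstant (d + 2) ^ 2)) with hB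
  refine ⟨B, (le_max_left _ _).trans (le_max_right _ _), (le_max_right _ _).trans (le_max_right _ _),
    fun n hn => ?_⟩
  have hn0 : (0 : ℝ) < n := by exact_mod_cast hn
  have hpos : 0 < (halfSpaceCount (d + 2) (n + 4) : ℝ) / halfSpaceCount (d + 2) (n + 2) := div_pos (ha _) (ha _)
  rcases Nat.lt_or_ge n N₁ with hlt | hge
  · have hφ : (halfSpaceCount (d + 2) (n + 2) : ℝ) / halfSpaceCount (d + 2) n ≤ c₂ := by
      rw [div_le_iff₀ (ha n)]
      have := halfSpaceCount_add_le_mul_count (d := d + 2) n 2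
      calc (halfSpaceCount (d + 2) (n + 2) : ℝ) ≤ (halfSpaceCount (d + 2) n : ℝ) * count (d + 2) 2 := by
            exact_mod_cast this
        _ = c₂ * halfSpaceCount (d + 2) n := by rw [hc₂]; ring
    have hBn : c₂ ≤ B / n := by
      rw [le_div_iff₀ hn0]
      have hle : (n : ℝ) ≤ (N₁ : ℝ) + 1 := by
        have : n ≤ N₁ + 1 := by omega
        exact_mod_cast this
      calc c₂ * (n : ℝ) ≤ c₂ * ((N₁ : ℝ) + 1) := mul_le_mul_of_nonneg_left hle hc₂0
        _ ≤ B := (le_max_right _ _).trans (le_max_left _ _)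
    linarith
  · have h := hK n hge
    have hDB : D / n ≤ B / n := div_le_div_of_nonneg_right ((le_max_left _ _).trans (le_max_left _ _)) hn0.le
    linarith

/-! ### The two sides of the rate -/

/-- **Upper side with exponent `1/3`**: `h_{N+2}/h_N − μ² ≤ K N^{-1/3}` for every `N ≥ 1` on `ℤ^{d+2}` — the abstract
`upper_rate_cubeRoot_sub` with `a = h`, `a₂(M) = c_{2M}` (cut inequality `h_{N+2M} ≤ h_N c_{2M}`) and the
Hammersley–Welsh envelope `c_n ≤ μ^n e^{κ√n}`. [cite: MadrasSlade1993, §7.5 eq. (7.5.1) and Lemma 7.3.1] -/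
theorem halfSpace_twoStep_ratio_sub_le_rpow (d : ℕ) : ∃ K : ℝ, ∀ N : ℕ, 1 ≤ N →
    (halfSpaceCount (d + 2) (N + 2) : ℝ) / halfSpaceCount (d + 2) N - connectiveConstant (d + 2) ^ 2 ≤
      K * (N : ℝ) ^ (-(1 : ℝ) / 3) := by
  set μ := connectiveConstant (d + 2) with hμdef
  have hμ1 : 1 ≤ μ := one_le_connectiveConstant (d + 2)
  have hμ0 : 0 < μ := by linarith
  have ha : ∀ n, (0 : ℝ) < halfSpaceCount (d + 2) n := fun n => by
    exact_mod_cast one_le_halfSpaceCount (d := d + 2) n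
  obtain ⟨B, hB1, -, hK⟩ := halfSpace_kesten_all d
  obtain ⟨κ, hκ⟩ := BDGS2012_HammersleyWelsh_holds (d + 2) (by omega)
  set κ' : ℝ := max κ 0 * Real.sqrt 2 with hκ'
  have hsub : ∀ N M : ℕ, (halfSpaceCount (d + 2) (N + 2 * M) : ℝ) ≤
      halfSpaceCount (d + 2) N * count (d + 2) (2 * M) := fun N M => by
    exact_mod_cast halfSpaceCount_add_le_mul_count (d := d + 2) N (2 * M)
  have hhi : ∀ M : ℕ, (count (d + 2) (2 * M) : ℝ) ≤ 1 * Real.exp (κ' * Real.sqrt M) * μ ^ (2 * M) := by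
    intro M
    have h1 := hκ (2 * M)
    have hs : Real.sqrt ((2 * M : ℕ) : ℝ) = Real.sqrt 2 * Real.sqrt M := by
      push_cast; exact Real.sqrt_mul (by norm_num) _
    have h2 : κ * Real.sqrt ((2 * M : ℕ) : ℝ) ≤ κ' * Real.sqrt M := by
      rw [hs, hκ', mul_assoc]
      exact mul_le_mul_of_nonneg_right (le_max_left _ _) (by positivity)
    calc (count (d + 2) (2 * M) : ℝ) ≤ μ ^ (2 * M) * Real.exp (κ * Real.sqrt ((2 * M : ℕ) : ℝ)) := h1
      _ ≤ μ ^ (2 * M) * Real.exp (κ' * Real.sqrt M) :=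
          mul_le_mul_of_nonneg_left (Real.exp_le_exp.2 h2) (pow_nonneg hμ0.le _)
      _ = 1 * Real.exp (κ' * Real.sqrt M) * μ ^ (2 * M) := by ring
  obtain ⟨K, hKr⟩ := KestenRateUpper.upper_rate_cubeRoot_sub (a := fun n => (halfSpaceCount (d + 2) n : ℝ))
    (a₂ := fun M => (count (d + 2) (2 * M) : ℝ)) (μ := μ) (B := B) (c := κ') (A := 1)
    ha hμ1 hB1 le_rfl hK hsub hhi
  refine ⟨max K 0, fun N hN => ?_⟩
  have hN0 : (0 : ℝ) < N := by exact_mod_cast hN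
  have hp : 0 ≤ (N : ℝ) ^ (-(1 : ℝ) / 3) := Real.rpow_nonneg hN0.le _
  rcases le_or_gt ((halfSpaceCount (d + 2) (N + 2) : ℝ) / halfSpaceCount (d + 2) N) (μ ^ 2) with h | h
  · have : 0 ≤ max K 0 * (N : ℝ) ^ (-(1 : ℝ) / 3) := mul_nonneg (le_max_right _ _) hp
    linarith
  · have hu := hKr N hN ((halfSpaceCount (d + 2) (N + 2) : ℝ) / halfSpaceCount (d + 2) N - μ ^ 2)
      (by linarith) (by linarith)
    have hle : K * (N : ℝ) ^ (-(1 : ℝ) / 3) ≤ max K 0 * (N : ℝ) ^ (-(1 : ℝ) / 3) :=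
      mul_le_mul_of_nonneg_right (le_max_left _ _) hp
    linarith

/-- **Lower side with exponent `1/3`**: `−K N^{-1/3} ≤ h_{N+2}/h_N − μ²` for every `N ≥ 1` on `ℤ^{d+2}` — the abstract
`lower_rate_cubeRoot_ins` (both residues, threshold `0`) with `a = h`, pieces `e(M) = b_{2M}`, the super-multiplicativity
`b_{2M} h_{N'} ≤ h_{N'+2M}` and the bridge envelope `e^{−c√n} μ^n ≤ b_n`.
[cite: MadrasSlade1993, §7.5 eqs. (7.5.1)–(7.5.2) and Lemma 7.3.1] -/
theorem le_halfSpace_twoStep_ratio_sub_rpow (d : ℕ) : ∃ K : ℝ, ∀ N : ℕ, 1 ≤ N →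
    -(K * (N : ℝ) ^ (-(1 : ℝ) / 3)) ≤
      (halfSpaceCount (d + 2) (N + 2) : ℝ) / halfSpaceCount (d + 2) N - connectiveConstant (d + 2) ^ 2 := by
  set μ := connectiveConstant (d + 2) with hμdef
  have hμ1 : 1 ≤ μ := one_le_connectiveConstant (d + 2)
  have hμ0 : 0 < μ := by linarith
  have ha : ∀ n, (0 : ℝ) < halfSpaceCount (d + 2) n := fun n => by
    exact_mod_cast one_le_halfSpaceCount (d := d + 2) n
  obtain ⟨B, hB1, hBμ, hK⟩ := halfSpace_kesten_all d
  obtain ⟨c₀, hc₀⟩ := exp_mul_pow_le_bridgeCount (d := d + 2)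
  set c : ℝ := max c₀ 0 * Real.sqrt 2 with hcdef
  have hc : 0 ≤ c := by positivity
  set e : ℕ → ℝ := fun M => (bridgeCount (d + 2) (2 * M) : ℝ) with hedef
  have hlo : ∀ M : ℕ, 2 ≤ M → Real.exp (-(c * Real.sqrt M)) * μ ^ (2 * M) ≤ 1 * e M := by
    intro M _
    rw [one_mul]
    have h1 := hc₀ (2 * M)
    have hs : Real.sqrt ((2 * M : ℕ) : ℝ) = Real.sqrt 2 * Real.sqrt M := by
      push_cast; exact Real.sqrt_mul (by norm_num) _
    have h2 : c₀ * Real.sqrt ((2 * M : ℕ) : ℝ) ≤ c * Real.sqrt M := by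
      rw [hs, hcdef, mul_assoc]
      exact mul_le_mul_of_nonneg_right (le_max_left _ _) (by positivity)
    calc Real.exp (-(c * Real.sqrt M)) * μ ^ (2 * M)
        ≤ Real.exp (-(c₀ * Real.sqrt ((2 * M : ℕ) : ℝ))) * μ ^ (2 * M) :=
          mul_le_mul_of_nonneg_right (Real.exp_le_exp.2 (neg_le_neg h2)) (pow_nonneg hμ0.le _)
      _ ≤ e M := h1
  have hSM : ∀ r : ℕ, ∀ N' M : ℕ, 0 ≤ N' → N' % 2 = r → 2 ≤ M →
      (halfSpaceCount (d + 2) N' : ℝ) * e M ≤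
        (2 * ((N' : ℝ) + 2 * M) + 3) ^ 6 * halfSpaceCount (d + 2) (N' + 2 * M) := by
    intro r N' M _ _ _
    have h1 : (halfSpaceCount (d + 2) N' : ℝ) * e M ≤ halfSpaceCount (d + 2) (N' + 2 * M) := by
      have h0 := bridgeCount_mul_halfSpaceCount_le (d := d + 2) (2 * M) N'
      rw [show 2 * M + N' = N' + 2 * M by ring] at h0
      have h0' : (bridgeCount (d + 2) (2 * M) : ℝ) * (halfSpaceCount (d + 2) N' : ℝ) ≤
          halfSpaceCount (d + 2) (N' + 2 * M) := by exact_mod_cast h0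
      have he : e M = (bridgeCount (d + 2) (2 * M) : ℝ) := rfl
      rw [he, mul_comm]
      exact h0'
    have hN' : (0 : ℝ) ≤ N' := Nat.cast_nonneg _
    have hM : (0 : ℝ) ≤ M := Nat.cast_nonneg _
    have hx1 : (1 : ℝ) ≤ 2 * ((N' : ℝ) + 2 * M) + 3 := by linarith
    have hpoly : (1 : ℝ) ≤ (2 * ((N' : ℝ) + 2 * M) + 3) ^ 6 := one_le_pow₀ hx1
    have h0 : (0 : ℝ) ≤ halfSpaceCount (d + 2) (N' + 2 * M) := Nat.cast_nonneg _
    calc (halfSpaceCount (d + 2) N' : ℝ) * e M ≤ 1 * halfSpaceCount (d + 2) (N' + 2 * M) := by rw [one_mul]; exact h1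
      _ ≤ (2 * ((N' : ℝ) + 2 * M) + 3) ^ 6 * halfSpaceCount (d + 2) (N' + 2 * M) :=
          mul_le_mul_of_nonneg_right hpoly h0
  -- the core, once per residue class
  have core : ∀ r : ℕ, ∃ K : ℝ, ∀ N : ℕ, 1 ≤ N → N % 2 = r → ∀ u : ℝ, 0 < u →
      (halfSpaceCount (d + 2) (N + 2) : ℝ) / halfSpaceCount (d + 2) N ≤ μ ^ 2 - u →
        u ≤ K * (N : ℝ) ^ (-(1 : ℝ) / 3) := by
    intro r
    obtain ⟨K, hKr⟩ := KestenRateLower.lower_rate_cubeRoot_ins (a := fun n => (halfSpaceCount (d + 2) n : ℝ))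
      (e := e) (μ := μ) (B := B) (c := c) (A := 1) (n₁ := 0) (r := r) ha hμ1 hB1 hBμ hc le_rfl hK hlo (hSM r)
    exact ⟨K, fun N hN hpar u hu hdev => hKr N (by omega) hpar u hu hdev⟩
  obtain ⟨K₀, hK₀⟩ := core 0
  obtain ⟨K₁, hK₁⟩ := core 1
  refine ⟨max (max K₀ K₁) 0, fun N hN => ?_⟩
  have hN0 : (0 : ℝ) < N := by exact_mod_cast hN
  have hp : 0 ≤ (N : ℝ) ^ (-(1 : ℝ) / 3) := Real.rpow_nonneg hN0.le _
  have hKmax0 : 0 ≤ max (max K₀ K₁) 0 := le_max_right _ _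
  rcases le_or_gt (μ ^ 2) ((halfSpaceCount (d + 2) (N + 2) : ℝ) / halfSpaceCount (d + 2) N) with h | h
  · have : 0 ≤ max (max K₀ K₁) 0 * (N : ℝ) ^ (-(1 : ℝ) / 3) := mul_nonneg hKmax0 hp
    linarith
  · set u : ℝ := μ ^ 2 - (halfSpaceCount (d + 2) (N + 2) : ℝ) / halfSpaceCount (d + 2) N with hu
    have hu0 : 0 < u := by rw [hu]; linarith
    have hdev : (halfSpaceCount (d + 2) (N + 2) : ℝ) / halfSpaceCount (d + 2) N ≤ μ ^ 2 - u := by rw [hu]; linarith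
    rcases Nat.mod_two_eq_zero_or_one N with hpar | hpar
    · have hv := hK₀ N hN hpar u hu0 hdev
      have hle : K₀ * (N : ℝ) ^ (-(1 : ℝ) / 3) ≤ max (max K₀ K₁) 0 * (N : ℝ) ^ (-(1 : ℝ) / 3) :=
        mul_le_mul_of_nonneg_right ((le_max_left _ _).trans (le_max_left _ _)) hp
      rw [hu] at hv
      linarith
    · have hv := hK₁ N hN hpar u hu0 hdev
      have hle : K₁ * (N : ℝ) ^ (-(1 : ℝ) / 3) ≤ max (max K₀ K₁) 0 * (N : ℝ) ^ (-(1 : ℝ) / 3) :=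
        mul_le_mul_of_nonneg_right ((le_max_right _ _).trans (le_max_left _ _)) hp
      rw [hu] at hv
      linarith

/-- **The two-step ratio rate for half-space walks of `ℤ^{d+2}` with Kesten's exponent on both sides, every `N ≥ 1`**:
`|h_{N+2}/h_N − μ²| ≤ K · N^{-1/3}` (sharpening the tree's `halfSpaceTwoStepRate_abs`, exponent `1/4`).  Print has the
limit only [cite: LawlerSchrammWerner2004SAW, Appendix A, (A.2)]; the `N^{-1/3}` rate is printed for all walks
[cite: MadrasSlade1993, §7.5 eq. (7.5.1)]. -/
theorem abs_halfSpace_twoStep_ratio_sub_le_rpow (d : ℕ) : ∃ K : ℝ, ∀ N : ℕ, 1 ≤ N →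
    |(halfSpaceCount (d + 2) (N + 2) : ℝ) / halfSpaceCount (d + 2) N - connectiveConstant (d + 2) ^ 2| ≤
      K * (N : ℝ) ^ (-(1 : ℝ) / 3) := by
  obtain ⟨K₁, h₁⟩ := halfSpace_twoStep_ratio_sub_le_rpow d
  obtain ⟨K₂, h₂⟩ := le_halfSpace_twoStep_ratio_sub_rpow d
  refine ⟨max K₁ K₂, fun N hN => ?_⟩
  have hN0 : (0 : ℝ) < N := by exact_mod_cast hN
  have hp : 0 ≤ (N : ℝ) ^ (-(1 : ℝ) / 3) := Real.rpow_nonneg hN0.le _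
  rw [abs_le]
  constructor
  · have := h₂ N hN
    have hle : K₂ * (N : ℝ) ^ (-(1 : ℝ) / 3) ≤ max K₁ K₂ * (N : ℝ) ^ (-(1 : ℝ) / 3) :=
      mul_le_mul_of_nonneg_right (le_max_right _ _) hp
    linarith
  · have := h₁ N hN
    have hle : K₁ * (N : ℝ) ^ (-(1 : ℝ) / 3) ≤ max K₁ K₂ * (N : ℝ) ^ (-(1 : ℝ) / 3) :=
      mul_le_mul_of_nonneg_right (le_max_left _ _) hp
    linarith

end Literature.Probability.RandomPlanarGeometry.SAW.Zd
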